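import Literature.AlgebraicGeometry.Deformation.LocalHilbertFunctor
import Literature.AlgebraicGeometry.HodgeTheory.BlochSeedHilbertPointSmooth
import HarnessLib

/-!
# Bloch 1972, Thm. (7.3) in the language of functors of Artin rings: the local Hilbert functor of a semiregular local
# complete intersection is smooth, and all its obstruction maps vanish

Family `hodge`, layer `Literature/AlgebraicGeometry/HodgeTheory` (literature-typing tranche LT-H1 «semiregularity consumers»,
cell `pub-hsemireg`). PROVED repackaging of the typed fact `Bloch1972_hilbertScheme_smoothAt_semiregular`
(`BlochSemiregularHilbertPointSmooth.lean`) on the carrier `Deformation.localHilbertFunctor` (`Deformation/LocalHilbertFunctor.lean`,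
[Hartshorne2010, §17]: the local Hilb functor `H_Z^X : Art_k → Sets` of embedded deformations as an `ArtinFunctor`); NO new
fact, no definition (D-0026). Nothing here asserts HC ∕ HC_AV ∕ any Weil-class statement, nor that any seed exists.

## Sources, verbatim

* [Bloch1972Semiregularity] S. Bloch, *Semi-regularity and de Rham cohomology*, Invent. Math. 17 (1972) 51–66, **Thm. (7.3)**
  (p. 64–65; in-cell OCR of the GDZ scan `pub-hsemireg/lit/Bloch1972-Invent17-GDZ/p064.txt:32`, journal copy acq-01573 cite-only):
  «Let `X` be smooth and projective over `ℂ`. Let `Z ⊂ X` be a local complete intersection which is semi-regular in `X`.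
  Then the corresponding point `Z ∈ Hilb(X∕ℂ)` is smooth.» — typed (infinitesimal-lifting form along small surjections,
  any model of `X_A ⊇ X_B ⊇ X`) as `Bloch1972_hilbertScheme_smoothAt_semiregular`; restated with proof in
  [BuchweitzFlenner2003, Cor. 7.10 with Rem. 7.11 (1)] and [BandieraLepriManetti2023, §1].
* [Manetti1999DeformationTheoryDGLA] M. Manetti, *Deformation theory via differential graded Lie algebras* (arXiv
  math/0507284), Def. 2.8: «A functor `F` is smooth if […] `F(A) → F(B)` is surjective for every surjective morphism of
  `S`-algebras `A → B`»; Def. 2.12 (obstruction theory `(V, v_e)`), Exercise p. 8: «If `F` is smooth then all the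
  obstruction maps are trivial» — typed in `Deformation/CompatibleObstructionTheories.lean` (`ArtinFunctor.IsSmooth`,
  `ArtinFunctor.ObstructionTheory`, `ObstructionTheory.ob_eq_zero_of_isSmooth`).
* [BandieraLepriManetti2023] Adv. Math. 435 (2023) 109358, §1 [corpus:paper:arxiv-2111.12985 p0001:L33–41]: «the cohomology
  group `H¹(Z, N_{Z|X})` is an obstruction space for the Hilbert functor of the closed immersion `Z ⊂ X` […] if the
  semiregularity map is injective, then `Z` has unobstructed embedded deformations in `X`»; **Cor. 1.2**
  [corpus:paper:doi-10-1016-j-aim-2023-109358 p0003:L39–42]: «every obstruction to embedded deformations of `Z` is contained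
  in the kernel of Bloch's semiregularity map».
* [Hartshorne2010] *Deformation Theory*, §17 p. 118 (the local Hilb functor), Cor. 4.7 and proof of Cor. 6.3 (smooth point
  of `Hilb` ⟺ infinitesimal lifting; «filtering […] we reduce to the case `𝔪J = 0`»); [StacksProject, Tag 06HH].

## What is proved (0 facts, 0 definitions)

* `localHilbertFunctor_isSmooth_of_isBlochSemiregular` — granting `Bloch1972_hilbertScheme_smoothAt_semiregular`: for `X` smooth
  projective of dimension `n` over `ℂ` and `ι₀ : Z ↪ X` a Bloch-semiregular regular immersion of codimension `p`,
  **`(Deformation.localHilbertFunctor X ι₀.ker).IsSmooth`** — `H_Z^X(A) → H_Z^X(B)` is onto for EVERY surjection of `Art_ℂ`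
  (the fact gives small surjections on any model; the models are Mathlib's chosen pullbacks and the tree's
  `Deformation.closedFibreι`; small ⟹ all is `ArtinFunctor.map_surjective_of_maximalIdeal_mul_ker`).
* `localHilbertFunctor_ob_eq_zero_of_isBlochSemiregular` — hence EVERY obstruction theory `(V, v_e)` of `H_Z^X` (complete or
  not) has `v_e ≡ 0`: the injective case of [BandieraLepriManetti2023, Cor. 1.2] in the tree's obstruction-theory vocabulary.
  The general kernel statement (obstructions ⊆ `ker σ` for non-injective `σ`) needs Bloch's map on `H¹(Z, 𝒩)` itself —
  the tree renders semiregularity through its Serre dual (`IsBlochSemiregular`) — and is NOT asserted here.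
* `HasBlochSeedAt.exists_seed_localHilbertFunctor_isSmooth`, `HasHyperbolicBlochSeed.exists_anchor_seed_localHilbertFunctor_isSmooth`
  — the №3 consumer forms (route `EightfoldBlochSeeds`, `BlochSeedDiscOne = HasHyperbolicBlochSeed 4 1`; PAD-4
  `stub_rung_pad4_seedAt … HasBlochSeedAt 4 …`): a Bloch seed on an abelian `2n`-fold is carried by a regular immersion
  whose local Hilbert functor is smooth (cf. `HasBlochSeedAt.exists_seed_hilbertPointSmooth`, same content in telescope form).

## References

* [Bloch1972Semiregularity] Invent. Math. 17 (1972), Thm. (7.3), Remark (7.5). [BuchweitzFlenner2003] Compositio 137 (2003),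
  Cor. 7.10, Rem. 7.11 (1). [BandieraLepriManetti2023] Adv. Math. 435 (2023), §1, Cor. 1.2.
* [Hartshorne2010] Deformation Theory, §17, Cor. 4.7, Cor. 6.3. [Manetti1999DeformationTheoryDGLA] Def. 2.8, Def. 2.12.
  [StacksProject] Tag 06HH. [GortzWedhorn2023] Prop. 27.174 (abelian varieties are smooth projective).
-/

noncomputable section

-- `(X ⊗ T).left = pullback X.hom T.hom` is `rfl` (`Over.tensorObj_left`) only at default transparency; as in Mathlib's
set_option backward.isDefEq.respectTransparency false -- `CategoryTheory.Monoidal.Cartesian.Over` itself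

open CategoryTheory Limits MonoidalCategory AlgebraicGeometry

namespace Literature.AlgebraicGeometry.HodgeTheory

open Literature.AlgebraicGeometry.Deformation Literature.AlgebraicTopology.SingularHomology

/-- **Bloch 1972, Thm. (7.3), in the language of functors of Artin rings: the local Hilbert functor of a semiregular
local complete intersection is smooth (unobstructed).** Granting the typed fact
`Bloch1972_hilbertScheme_smoothAt_semiregular` («Let `X` be smooth and projective over `ℂ`. Let `Z ⊂ X` be a local
complete intersection which is semi-regular in `X`. Then the corresponding point `Z ∈ Hilb(X∕ℂ)` is smooth»,
infinitesimal-lifting form along SMALL surjections), the local Hilbert functor `H_Z^X : Art_ℂ → Sets` of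
`Z = V(ker ι₀) ⊆ X` (`Deformation.localHilbertFunctor`, [Hartshorne2010, §17]) is SMOOTH in the sense of
[Manetti1999DeformationTheoryDGLA, Def. 2.8] — `H_Z^X(A) → H_Z^X(B)` is surjective for EVERY surjection `A ↠ B` of
`Art_ℂ` (the passage from small to all surjections is the tree's `ArtinFunctor.map_surjective_of_maximalIdeal_mul_ker`,
[StacksProject, Tag 06HH]; the passage from the fact's «any model of `X_A ⊇ X_B ⊇ X`, any closed `Z_B`» telescope to
the functor is `Deformation.localHilbertFunctor_isSmooth_of_forall_extends`, fed with Mathlib's chosen pullbacks,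
the closed-fibre section `Deformation.closedFibreι` and the canonical lift `Z → Z_B` of
`Deformation.isPullback_lift_of_ker_comap_eq`). PROVED repackaging; no new fact (D-0026).
[cite: Bloch1972Semiregularity, Thm. (7.3)] [cite: BuchweitzFlenner2003, Cor. 7.10 with Rem. 7.11 (1)]
[cite: Hartshorne2010, §17 p. 118 and Cor. 4.7] [cite: Manetti1999DeformationTheoryDGLA, Def. 2.8] -/
theorem localHilbertFunctor_isSmooth_of_isBlochSemiregular (hBl : Bloch1972_hilbertScheme_smoothAt_semiregular)
    {X : Motives.SchemeOver ℂ} {n p : ℕ} (hX : Motives.IsSmoothProjective n X) {Z : Scheme.{0}} {ι₀ : Z ⟶ X.left}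
    (hι : IsRegularImmersionOfCodim ι₀ p) (hs : IsBlochSemiregular ι₀ n p) :
    (localHilbertFunctor X ι₀.ker).IsSmooth := by
  haveI := hι.isClosedImmersion
  refine localHilbertFunctor_isSmooth_of_forall_extends fun A B f hf hsmall ZB ιB hcl hflat hker => ?_
  obtain ⟨jZ, sqZ⟩ := isPullback_lift_of_ker_comap_eq ι₀ ιB (closedFibreι X B) hker
  -- Bloch's telescope, fed with Mathlib's chosen models `X_A = (X ⊗ Spec A).left = pullback X.hom (Spec A → Spec ℂ)`
  exact hBl n p hX ι₀ hι hs A B f hf hsmall B.residue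
    (XA := (X ⊗ A.specOver).left) (XB := (X ⊗ B.specOver).left)
    (pullback.fst X.hom A.specOver.hom) (pullback.snd X.hom A.specOver.hom) (isPullback_fst_snd_specOver X A)
    (X ◁ ArtAlg.specOverMap f).left (pullback.snd X.hom B.specOver.hom) (isPullback_whiskerLeft_specOverMap X f)
    (closedFibreι X B) (isPullback_closedFibreι X B) (closedFibreι_whiskerLeft_fst X f)
    ιB hcl hflat jZ sqZ

/-- **Corollary: every obstruction map of `H_Z^X` vanishes** — for EVERY obstruction theory `(V, v_e)` of the local
Hilbert functor of a semiregular local complete intersection ([Manetti1999DeformationTheoryDGLA, Def. 2.12]; the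
tree's `ArtinFunctor.ObstructionTheory`, complete or not) and every small extension `e`, `v_e ≡ 0` (loc. cit.,
Exercise p. 8: «If `F` is smooth then all the obstruction maps are trivial», the tree's
`ObstructionTheory.ob_eq_zero_of_isSmooth`). This is the semiregular (injective) case of [BandieraLepriManetti2023,
Cor. 1.2] («every obstruction to embedded deformations of `Z` is contained in the kernel of Bloch's semiregularity
map») in the tree's obstruction-theory vocabulary; the general kernel statement needs Bloch's map on `H¹(Z, 𝒩)`
itself (the tree renders semiregularity through its Serre dual) and is not asserted here.
[cite: Bloch1972Semiregularity, Thm. (7.3)] [cite: Manetti1999DeformationTheoryDGLA, Def. 2.12 and Exercise p. 8]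
[cite: BandieraLepriManetti2023, Cor. 1.2] -/
theorem localHilbertFunctor_ob_eq_zero_of_isBlochSemiregular (hBl : Bloch1972_hilbertScheme_smoothAt_semiregular)
    {X : Motives.SchemeOver ℂ} {n p : ℕ} (hX : Motives.IsSmoothProjective n X) {Z : Scheme.{0}} {ι₀ : Z ⟶ X.left}
    (hι : IsRegularImmersionOfCodim ι₀ p) (hs : IsBlochSemiregular ι₀ n p)
    {V : Type} [AddCommGroup V] [Module ℂ V] (O : (localHilbertFunctor X ι₀.ker).ObstructionTheory V)
    {R₁ R₀ : ArtAlg.{0} ℂ} (e : R₁ →ₐ[ℂ] R₀) (he : IsSmallExt ℂ e) (a : (localHilbertFunctor X ι₀.ker).obj R₀) :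
    O.ob e he a = 0 :=
  O.ob_eq_zero_of_isSmooth (localHilbertFunctor_isSmooth_of_isBlochSemiregular hBl hX hι hs) e he a

/-- **A Bloch seed has a smooth local Hilbert functor** (№3 consumer form of
`HasBlochSeedAt.exists_seed_hilbertPointSmooth`, `BlochSeedHilbertPointSmooth.lean`): granting
`Bloch1972_hilbertScheme_smoothAt_semiregular`, a Bloch seed for `q·hⁿ + w` on an abelian `2n`-fold `P`
(`HasBlochSeedAt n P h w`, [Bloch1972Semiregularity, Remark (7.5)]) is carried by a Bloch-semiregular regular immersion
`i : Z ↪ P` of codimension `n` whose local Hilbert functor `H_Z^P` is smooth. PROVED composition; no new fact.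
[cite: Bloch1972Semiregularity, Thm. (7.3) and Remark (7.5)] [cite: GortzWedhorn2023, Prop. 27.174] -/
theorem HasBlochSeedAt.exists_seed_localHilbertFunctor_isSmooth (hBl : Bloch1972_hilbertScheme_smoothAt_semiregular)
    {n : ℕ} {P : Motives.AbelianVariety ℂ} {h : complexBetti P.X 2} {w : complexBetti P.X (2 * n)}
    (hP : P.dim = 2 * n) (hS : HasBlochSeedAt n P h w) :
    ∃ (Z : Scheme.{0}) (i : Z ⟶ P.X.left) (q : ℚ),
      IsClosedImmersion i ∧ IsRegularImmersionOfCodim i n ∧ AlgebraicGeometry.IsIntegral Z ∧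
      (∀ z ∈ Set.range i.base, (n : ℕ∞) ≤ Order.coheight z) ∧
      IsBlochSemiregular i (2 * n) n ∧
      ((q : ℚ) : ℂ) • cupPowTwo h n + w ∈ classesSupportedOn P.X (Set.range i.base) (2 * n) ∧
      (localHilbertFunctor P.X i.ker).IsSmooth := by
  obtain ⟨Z, i, q, hi, hreg, hint, hcoh, hsr, hsupp⟩ := hS
  have hX : Motives.IsSmoothProjective (2 * n) P.X := by
    rw [← hP]
    exact Motives.AbelianVariety.isSmoothProjective_holds
  exact ⟨Z, i, q, hi, hreg, hint, hcoh, hsr, hsupp, localHilbertFunctor_isSmooth_of_isBlochSemiregular hBl hX hreg hsr⟩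

/-- **The hyperbolic-seed form** (binder shape of №3's `BlochSeedDiscOne = HasHyperbolicBlochSeed 4 1`): granting
`Bloch1972_hilbertScheme_smoothAt_semiregular`, a hyperbolic Bloch seed in dimension `2n` yields an anchor `P` with
`P.dim = 2n` and a Bloch-semiregular regular immersion `i : Z ↪ P` of codimension `n` whose local Hilbert functor is
smooth. PROVED composition; no new fact. [cite: Bloch1972Semiregularity, Thm. (7.3) and Remark (7.5)] -/
theorem HasHyperbolicBlochSeed.exists_anchor_seed_localHilbertFunctor_isSmooth
    (hBl : Bloch1972_hilbertScheme_smoothAt_semiregular) {n d : ℕ} (hS : HasHyperbolicBlochSeed n d) :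
    ∃ (P : Motives.AbelianVariety ℂ) (Z : Scheme.{0}) (i : Z ⟶ P.X.left),
      P.dim = 2 * n ∧ IsClosedImmersion i ∧ IsRegularImmersionOfCodim i n ∧ IsBlochSemiregular i (2 * n) n ∧
      (localHilbertFunctor P.X i.ker).IsSmooth := by
  obtain ⟨P, ψ₀, e, a, w, hP, -, -, -, -, -, -, -, hseed⟩ := hS
  obtain ⟨Z, i, -, hi, hreg, -, -, hsr, -, hsm⟩ := hseed.exists_seed_localHilbertFunctor_isSmooth hBl hP
  exact ⟨P, Z, i, hP, hi, hreg, hsr, hsm⟩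

end Literature.AlgebraicGeometry.HodgeTheory

end
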